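import Summits.KontsevichZagierPeriods.Zeta5Search.LaiSweepShard

/-!
# `κ₃` sweep certificate — shard file 011 of 127 (shards 77–83 of 889)

HONEST FRAMING. Systematic search; no irrationality claim unless certified. This file only checks,
by `decide +kernel`, shards 77–83 of the order-cell sweep of the `κ₃` point `(74, 2180, 444; δ74)`
(engine `LaiSweepEngine`, soundness `LaiSweepJump/Free/Eval/Shard/Kappa3`; a shard is `⟨regime, n,
p, q, p', q', Lo, Up⟩`: `n` cells from `p/q` to `p'/q'` with integer rate sums in `[Lo, Up]`, `K =
128`, `D = 2^40`). It draws NO conclusion: only the capstone `LaiKappa3SweepCert`, which needs all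
127 shard files, does. Kernel cost of this file ≈ 560 cells × 0.3 s.
-/

namespace Summit.KontsevichZagierPeriods.Zeta5Search.Sweep

set_option maxHeartbeats 100000000 in
/-- Shard 77: 80 cells of regime A from `9/437` to `53/2542`.
[cite: Lai2024BallRivoal, §4 Lemma 4.3] -/
theorem shard077 :
    Shard.check 128 (2^40)
      ⟨false, 80, 9, 437, 53, 2542, 76572599489118, 76609480851089⟩ = true := by
  decide +kernel

set_option maxHeartbeats 100000000 in
/-- Shard 78: 80 cells of regime A from `53/2542` to `47/2232`.
[cite: Lai2024BallRivoal, §4 Lemma 4.3] -/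
theorem shard078 :
    Shard.check 128 (2^40)
      ⟨false, 80, 53, 2542, 47, 2232, 65751956165524, 65778957221954⟩ = true := by
  decide +kernel

set_option maxHeartbeats 100000000 in
/-- Shard 79: 80 cells of regime A from `47/2232` to `47/2202`.
[cite: Lai2024BallRivoal, §4 Lemma 4.3] -/
theorem shard079 :
    Shard.check 128 (2^40)
      ⟨false, 80, 47, 2232, 47, 2202, 88752509894987, 88789179824892⟩ = true := by
  decide +kernel

set_option maxHeartbeats 100000000 in
/-- Shard 80: 80 cells of regime A from `47/2202` to `8/371`.
[cite: Lai2024BallRivoal, §4 Lemma 4.3] -/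
theorem shard080 :
    Shard.check 128 (2^40)
      ⟨false, 80, 47, 2202, 8, 371, 65475589860082, 65499494863954⟩ = true := by
  decide +kernel

set_option maxHeartbeats 100000000 in
/-- Shard 81: 80 cells of regime A from `8/371` to `55/2518`.
[cite: Lai2024BallRivoal, §4 Lemma 4.3] -/
theorem shard081 :
    Shard.check 128 (2^40)
      ⟨false, 80, 8, 371, 55, 2518, 80893102718881, 80936724877058⟩ = true := by
  decide +kernel

set_option maxHeartbeats 100000000 in
/-- Shard 82: 80 cells of regime A from `55/2518` to `29/1312`.
[cite: Lai2024BallRivoal, §4 Lemma 4.3] -/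
theorem shard082 :
    Shard.check 128 (2^40)
      ⟨false, 80, 55, 2518, 29, 1312, 73576218437253, 73607203383736⟩ = true := by
  decide +kernel

set_option maxHeartbeats 100000000 in
/-- Shard 83: 80 cells of regime A from `29/1312` to `29/1299`.
[cite: Lai2024BallRivoal, §4 Lemma 4.3] -/
theorem shard083 :
    Shard.check 128 (2^40)
      ⟨false, 80, 29, 1312, 29, 1299, 60320192026601, 60344862243011⟩ = true := by
  decide +kernel

/-- The checked shards of this file, in order. [folklore] -/
def shards011 : List (CheckedShard 128 (2^40)) :=
  [⟨_, shard077⟩, ⟨_, shard078⟩, ⟨_, shard079⟩, ⟨_, shard080⟩, ⟨_, shard081⟩,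
    ⟨_, shard082⟩, ⟨_, shard083⟩]

end Summit.KontsevichZagierPeriods.Zeta5Search.Sweep
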